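/-
Copyright (c) 2026 the pub-hodgecm-mathlib formalisation cell (harness21).  Prover seat hodgecm-mathlib-LH4-p08 (g10), req620 Track A «(D-RAM) FOUR-FRAME» squad, helper lane
on h413 = stmt-HodgeConjecture-24833 (count-neutral).  β sub-dealer LH4-p05 (g8) LEDGER #12∕#13: ROW R6 «SPECIAL κ-CLASSES», tower 3 — THE HEAD in record letters
(statement-first SIG v1 8802be45, squad bus 2026-09-04 16:0xZ; F0P3a-p01 (g37) LEDGER #18: the optional cross-check of `hR6₃`).  2026-09-04.
-/
import Summits.HodgeConjecture.HodgeConjecture.Theorems.F0P3cDyRamLabelledOddKappaClassSumG3           -- ★ (this seat): the stratum value below the read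
import Summits.HodgeConjecture.HodgeConjecture.Theorems.F0P3cDyRamLabelledOddKappaLocusAboveReadG3   -- ★ p861773 (this seat): zero above the read off the foot; ★ parity
import Summits.HodgeConjecture.HodgeConjecture.Theorems.F0P3cDyRamTowerSignRelationsDeep        -- ★ p861198 (LH4-p06): `normSign_towerSign_eq_of_isElementDatum_of_deep₃` (ω_B = ω_A deep) [ED. 2]
import Summits.HodgeConjecture.HodgeConjecture.Theorems.F0P3cDyRamStageOneBDerivedDefs          -- DEFS: `n0DerivedOfRecord`, `mcOfRecord_le_n0DerivedOfRecord` [ED. 2]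
import Summits.HodgeConjecture.HodgeConjecture.Theorems.F0P3cDyRamDiagonalKappaCoreHangingClass  -- ★ (LH7-p05): `two_le_d_of_v_two_lt_one` [ED. 2]
import HarnessLib

/-!
# Crux `H413`, line LH4 «(D-RAM) FOUR-FRAME» — (β) Stage B, β-BOARD row R6 (tower 3): THE κ-CLASS ROW OF TOWER 3 IN RECORD LETTERS —
# `Σᶠ_{stratum (2ρ+s, 2ρ+s, 2ρ) ∧ shell} m^Λ_i∕[𝒰:N′] = (0, 0, ω(−1)ω(e_B)∕2 · q^{2ρ−1+s∕2} · ((q−1)[2d+ℓ₀+2ρ+s ≤ n₃] − [n₃+2 = 2d+ℓ₀+2ρ+s]))_i` on the κ-locus `2ρ+ℓ₀ = n₂`, off the foot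

Cell `hodgecm-mathlib` (D-0151), FLOOR 0, crux item H413 = `stmt-HodgeConjecture-24833`, route `HCCMUnconditional`; squad F0∕P3c∕LH4.  THEOREMS ONLY (no `def`, no instance, no
notation, no `sorry`, default heartbeats); ★-only imports; lane `--supports stmt-HodgeConjecture-24833 --as helper` (count-neutral); pays NO row, states NO law.

WHAT.  `finsum_stratum_G3_kappaLocus_shell_labelledOdd_div_relIndex_eq` — the tower-3 κ-CLASS ROW in the letters of F0P3a-p01 (g37)'s tower-3 dispatcher (★ `…RestDispatchG3`,
binder `hR6`; this seat's SIG v1 8802be45): element datum at threshold `N₀ ≥ 3d − 2 + ℓ₀`, `N₀ ≥ mc`, `T = diag(α, β, 1)`, unit tokens `e_B` (depth `(n₁−ℓ₀)∕2`), `e_C` (depth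
`(n₃−ℓ₀)∕2`) read at `ϖ^{m*}`, glue parameters `ρ ≥ 1`, `s ≥ 1` EVEN, κ-locus `2ρ + ℓ₀ = n₂`, off the foot `n₃ ≠ n₂ + s`.  Two regimes:
* ABOVE THE READ (`n₃ < 2ρ + s + ℓ₀`): the stratum is EMPTY off the foot (★ p861773), and both brackets vanish (`2d ≥ 2`).
* BELOW THE READ (`2ρ + s + ℓ₀ < n₃`): the datum is isosceles with `n₁ = n₂` (★ `isoceles_of_isElementDatum`), `n₃ ≡ ℓ₀ (mod 2)` (★ parity) gives the read `2k₃ + ℓ₀ = n₃`,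
  `N₀ ≥ 3d − 2 + ℓ₀` gives `d ≤ ρ`, and ★ `…KappaClassSumG3` §3 is the value with `t = s∕2`, `t′ = k₃ − ρ − t` (`[d ≤ t′] = [2d+ℓ₀+2ρ+s ≤ n₃]`, `[t′+1 = d] = [n₃+2 = 2d+ℓ₀+2ρ+s]`).
This is LH4-cdis1 (g0)'s KAPPA-CLASS-RULE ∕ R6-DERIVATION v2's `κ₃(ρ, s)` and, summed over `s` by ★ p861700 `kappaClass_line_total`, F0P3a-p01 (g37)'s fork (a); an independent
cross-check of the `hR6₃` row that the β chair obtains by the `(0 2)∘α⁻¹` transport of the tower-1 head (LEDGER #18).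
ED. 2 (`kappaRow_G3_ofRecord`).  THE `hR6₃` BINDER OF ★ p861938 `…OddLabelledRestOfRows.restSum_eq_restTarget_of_rows` PAID BY NAME, WITHOUT THE (0 2)∘α⁻¹ TRANSPORT: at the
datum of record (`N₀ = n0DerivedOfRecord d`; ★ `mcOfRecord_le_n0DerivedOfRecord`, `3d − 2 + ℓ₀ ≤ mc`, ★ `two_le_d_of_v_two_lt_one`) and in the two-token normal form
`(ω(−1)ω_B + ω(−1)ω_A)∕4` of LH4-p10's `harith`: where the bracket `F(n₃)` is alive the datum is deep (`n₁ = n₂`, `n₁ + 2d ≤ n₃` by parity and `2 ∣ s`), so `ω_B = ω_A`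
(★ `normSign_towerSign_eq_of_isElementDatum_of_deep₃`) and `(ω(−1)ω_B + ω(−1)ω_A)∕4 = ω(−1)ω_B∕2`; where it is dead both sides vanish.
HONEST LABEL.  Count-neutral; the κ-row∕hRest∕(β-BAL)∕(β)∕T₊ remain OPEN; `HC_CM` is proved only modulo the 7 printed citations (2 remaining named inputs: hLiu418 =
`stmt-HodgeConjecture-24832`, h413 = `stmt-HodgeConjecture-24833`) until rung 0 closes.

## References
* [Kottwitz1986BaseChangeUnits] R. E. Kottwitz, *Base change for unit elements of Hecke algebras*, Compositio Math. 60 (1986), §1 pp. 240–241 (signed lattice counts by torus orbits).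
* [LanglandsShelstad1987] R. P. Langlands, D. Shelstad, *On the definition of transfer factors*, Math. Ann. 278 (1987), §3 (κ-signs as characters).
* [Rogawski1990] J. D. Rogawski, *Automorphic Representations of Unitary Groups in Three Variables*, Ann. of Math. Stud. 123 (1990), §4.9 Prop. 4.9.1 (a)(b) p. 55, §4.10 p. 58.
* [Serre1979] J.-P. Serre, *Local Fields*, GTM 67 (1979), Ch. V §3 Cor. 3, Ch. XV §2 (norm residue symbol of a ramified quadratic extension).
-/

set_option autoImplicit false

noncomputable section

namespace Summit.HodgeConjecture.HodgeConjecture.Cruxes.H413.F0P3cDyRamLabelledOddKappaClassG3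

open Literature.NumberTheory.Automorphic Literature.NumberTheory.Automorphic.HermitianLattice
open Literature.NumberTheory.Automorphic.UnitaryLatticeTree Literature.NumberTheory.Automorphic.UnitaryThreeFourFrame
open Literature.NumberTheory.LocalFields Literature.NumberTheory.LocalFields.WildQuadraticDatum
open Summit.HodgeConjecture.HodgeConjecture.Cruxes.H413.F0P3cDyRamFourFramePieces
open Summit.HodgeConjecture.HodgeConjecture.Cruxes.H413.F0P3cDyRamFourFrameCensusDefs
open Summit.HodgeConjecture.HodgeConjecture.Cruxes.H413.F0P3cDyRamStageOneBDefs (mcOfRecord)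
open Summit.HodgeConjecture.HodgeConjecture.Cruxes.H413.F0P3cDyRamDiagonalTorusDefs
open Summit.HodgeConjecture.HodgeConjecture.Cruxes.H413.F0P3cDyRamDiagonalStrataDefs
open Summit.HodgeConjecture.HodgeConjecture.Cruxes.H413.F0P3cDyRamLabelledOddCountDefs
open Summit.HodgeConjecture.HodgeConjecture.Cruxes.H413.F0P3cDyRamLabelledOddKappaClassSumG3 (finsum_stratum_G3_kappaLocus_shell_labelledOdd_div_relIndex_eq_of_lt_read)
open Summit.HodgeConjecture.HodgeConjecture.Cruxes.H413.F0P3cDyRamLabelledOddKappaLocusAboveReadG3 (finsum_stratum_G3_shell_labelledOdd_div_relIndex_eq_zero_of_offFoot_of_read_lt)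
open Summit.HodgeConjecture.HodgeConjecture.Cruxes.H413.F0P3cDyRamElementDatumParity (depth_mod_two_eq_of_isElementDatum isoceles_of_isElementDatum)
open Summit.HodgeConjecture.HodgeConjecture.Cruxes.H413.F0P3cDyRamStageOneBDerivedDefs (n0DerivedOfRecord mcOfRecord_le_n0DerivedOfRecord)
open Summit.HodgeConjecture.HodgeConjecture.Cruxes.H413.F0P3cDyRamTowerSignRelationsDeep (normSign_towerSign_eq_of_isElementDatum_of_deep₃)
open Summit.HodgeConjecture.HodgeConjecture.Cruxes.H413.F0P3cDyRamDiagonalKappaCoreHangingClass (two_le_d_of_v_two_lt_one)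
open scoped Valued WithZero Matrix MatrixGroups

variable {K : Type} [Field K] [Valued K ℤᵐ⁰] [CompleteSpace K] [Fintype 𝓀[K]] {σ : K →+* K} {ϖ : K} {d t : ℕ} {α β : K} {N₀ n₁ n₂ n₃ : ℕ}

open Classical in
/-- **THE κ-CLASS ROW OF TOWER 3** (record letters; F0P3a-p01 (g37)'s dispatcher binder `hR6` with the closed form of R6-DERIVATION v2 §4): on the κ-locus `2ρ + ℓ₀ = n₂`, off
the foot `n₃ ≠ n₂ + s`, `s` even, the glued stratum `(2ρ+s, 2ρ+s, 2ρ)` of `T = diag(α, β, 1)` carries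
`Σᶠ_{M ∈ stratum ∧ shell} m^Λ_i(M)∕[𝒰 : N(S̃(M))] = (0, 0, ω(−1)ω(e_B)∕2 · q^{2ρ−1+s∕2} · ((q−1)·[2d+ℓ₀+2ρ+s ≤ n₃] − [n₃+2 = 2d+ℓ₀+2ρ+s]))_i` — empty above the read (★ p861773),
★ `…KappaClassSumG3` below it. [cite: Kottwitz1986BaseChangeUnits, §1 pp. 240–241] [cite: LanglandsShelstad1987, §3] [cite: Rogawski1990, §4.9 Prop. 4.9.1 (a)(b) p. 55]
[cite: Serre1979, Ch. V §3 Cor. 3; Ch. XV §2] -/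
theorem finsum_stratum_G3_kappaLocus_shell_labelledOdd_div_relIndex_eq (hD : IsRamifiedQuadraticDatum σ ϖ d t) (h2 : Valued.v (2 : K) < 1) (h2d : 2 ≤ d)
    (hE : IsElementDatum σ ϖ N₀ α β n₁ n₂ n₃) (hN₀ : 3 * d - 2 + d % 2 ≤ N₀) (hmc : mcOfRecord d ≤ N₀)
    (T : GL (Fin 3) K) (hT : (T : Matrix (Fin 3) (Fin 3) K) = Matrix.diagonal ![α, β, 1])
    {eB : K} (hσeB : σ eB = eB) (heB1 : Valued.v eB = 1)
    (heB : Valued.v ((ϖ ^ mstarOfRecord d)⁻¹ * ((β - 1) * ((ϖ * σ ϖ) ^ ((n₁ - d % 2) / 2))⁻¹ - eB * ((ϖ - σ ϖ) * ((ϖ * σ ϖ) ^ ((d - d % 2) / 2))⁻¹))) ≤ 1)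
    {eC : K} (hσeC : σ eC = eC) (heC1 : Valued.v eC = 1)
    (heC : Valued.v ((ϖ ^ mstarOfRecord d)⁻¹ * ((β - α) * ((ϖ * σ ϖ) ^ ((n₃ - d % 2) / 2))⁻¹ - eC * ((ϖ - σ ϖ) * ((ϖ * σ ϖ) ^ ((d - d % 2) / 2))⁻¹))) ≤ 1)
    (ρ s : ℕ) (hρ : 1 ≤ ρ) (hs : 1 ≤ s) (h2s : 2 ∣ s) (hκ : 2 * ρ + d % 2 = n₂) (hfoot : n₃ ≠ n₂ + s) (i : Fin 3) :
    ∑ᶠ M ∈ {M : Submodule 𝒪[K] (Fin 3 → K) | M ∈ stratum σ ϖ T ![2 * ρ + s, 2 * ρ + s, 2 * ρ] ∧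
        (LatticeInLevel ϖ (d % 2) (Matrix.diagonal ![α - 1, β - 1, 0]) M ∧ ¬ LatticeInLevel ϖ (d % 2 + 1) (Matrix.diagonal ![α - 1, β - 1, 0]) M ∧
          LatticeInLevel ϖ (mcOfRecord d) (Matrix.diagonal ![(α - 1) * (α - 1), (β - 1) * (β - 1), 0]) M)},
      (labelledOddCount σ ϖ 0 i (valueClassLabel σ ϖ (α - 1) (β - 1) (mstarOfRecord d) d) M : ℚ) /
        ((((unitStabilizer M).map (unitNormMap σ 3)).relIndex (fixedUnitTorus σ 3) : ℕ) : ℚ) =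
      (![(0 : ℚ), 0,
          (normSign σ (-1 : K) : ℚ) * (normSign σ eB : ℚ) / 2 * (Fintype.card 𝓀[K] : ℚ) ^ (2 * ρ - 1 + s / 2) *
            ((if 2 * d + d % 2 + 2 * ρ + s ≤ n₃ then (Fintype.card 𝓀[K] : ℚ) - 1 else 0) - (if n₃ + 2 = 2 * d + d % 2 + 2 * ρ + s then 1 else 0))] : Fin 3 → ℚ) i := by
  have hdN₀ : d ≤ N₀ := by omega
  by_cases hlt : n₃ < 2 * ρ + s + d % 2
  · -- above the read, off the foot: the stratum is empty and both brackets vanish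
    rw [finsum_stratum_G3_shell_labelledOdd_div_relIndex_eq_zero_of_offFoot_of_read_lt hD hE hdN₀ T hT ρ s hρ hs h2s hfoot hlt (mcOfRecord d) i _,
      if_neg (by omega : ¬ 2 * d + d % 2 + 2 * ρ + s ≤ n₃), if_neg (by omega : ¬ n₃ + 2 = 2 * d + d % 2 + 2 * ρ + s)]
    fin_cases i <;> simp
  · -- below the read: isosceles `n₁ = n₂`, the read `2k₃ + ℓ₀ = n₃`, `d ≤ ρ`, and ★ `…KappaClassSumG3`
    obtain ⟨t', rfl⟩ := h2s
    obtain ⟨-, -, -, -, -, -, -, -, -, hN₂, -⟩ := id hE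
    obtain ⟨-, -, h3⟩ := depth_mod_two_eq_of_isElementDatum hD hE hdN₀
    have h12 : n₁ = n₂ := by rcases isoceles_of_isElementDatum hD hE with h | h | h <;> omega
    obtain ⟨k₃, hk₃⟩ : ∃ k : ℕ, 2 * k + d % 2 = n₃ := ⟨(n₃ - d % 2) / 2, by omega⟩
    have hlt' : 2 * ρ + 2 * t' < 2 * k₃ := by omega
    have hdρ : d ≤ ρ := by omega
    have hn₁ : (n₁ - d % 2) / 2 = ρ := by omega
    have hn₃ : (n₃ - d % 2) / 2 = k₃ := by omega
    rw [hn₁, show mstarOfRecord d = d % 2 + 2 * d - 1 from rfl] at heB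
    rw [hn₃, show mstarOfRecord d = d % 2 + 2 * d - 1 from rfl] at heC
    have hc1 : d ≤ k₃ - ρ - t' ↔ 2 * d + d % 2 + 2 * ρ + 2 * t' ≤ n₃ := by omega
    have hc2 : k₃ - ρ - t' + 1 = d ↔ n₃ + 2 = 2 * d + d % 2 + 2 * ρ + 2 * t' := by omega
    have hexp : 2 * ρ + t' - 1 = 2 * ρ - 1 + 2 * t' / 2 := by omega
    rw [finsum_stratum_G3_kappaLocus_shell_labelledOdd_div_relIndex_eq_of_lt_read hD h2 h2d hE hmc T hT hρ (by omega : 1 ≤ t') hdρ hκ h12 k₃ hlt' hk₃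
        hσeC heC1 heC hσeB heB1 heB i, Nat.card_eq_fintype_card, hexp, if_congr hc1 rfl rfl, if_congr hc2 rfl rfl]

/-! ## ED. 2  The `hR6₃` binder of ★ p861938 paid by name (two-token normal form, datum of record) -/

open Classical in
/-- **`hR6₃` OF RECORD — THE κ-CLASS ROW OF TOWER 3 IN THE TWO-TOKEN NORMAL FORM** (★ p861938 `restSum_eq_restTarget_of_rows`'s binder `hR6₃` VERBATIM at the datum of record,
tokens `e_A` of `α − 1` at depth `(n₂−ℓ₀)∕2`, `e_B` of `β − 1` at `(n₁−ℓ₀)∕2`, `e_C` of `β − α` at `(n₃−ℓ₀)∕2`, read at `ϖ^{m*}`): for all `ρ ≥ 1`, even `s ≥ 1`, `2ρ + ℓ₀ = n₂`, `n₃ ≠ n₂ + s`,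
`Σᶠ_{stratum (2ρ+s, 2ρ+s, 2ρ) ∧ shell} m^Λ_i∕[𝒰:N′] = (0, 0, ω(−1)ω_B + ω(−1)ω_A)_i ∕ 4 · q^{2ρ−1+s∕2} · ((q−1)[2d+ℓ₀+2ρ+s ≤ n₃] − [n₃+2 = 2d+ℓ₀+2ρ+s])` — §1 plus `ω_B = ω_A` where the
bracket is alive (★ deep relation I). [cite: Kottwitz1986BaseChangeUnits, §1 pp. 240–241] [cite: Rogawski1990, §4.9 Prop. 4.9.1 (a)(b) p. 55] [cite: Serre1979, Ch. V §3 Cor. 3; Ch. XV §2] -/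
theorem kappaRow_G3_ofRecord (h2 : Valued.v (2 : K) < 1) (hD : IsRamifiedQuadraticDatum σ ϖ d t)
    (hE : IsElementDatum σ ϖ (n0DerivedOfRecord d) α β n₁ n₂ n₃)
    (T : GL (Fin 3) K) (hT : (T : Matrix (Fin 3) (Fin 3) K) = Matrix.diagonal ![α, β, 1]) {eA eB eC : K}
    (hσeA : σ eA = eA) (heA1 : Valued.v eA = 1)
    (heA : Valued.v ((ϖ ^ mstarOfRecord d)⁻¹ * ((α - 1) * ((ϖ * σ ϖ) ^ ((n₂ - d % 2) / 2))⁻¹ - eA * ((ϖ - σ ϖ) * ((ϖ * σ ϖ) ^ ((d - d % 2) / 2))⁻¹))) ≤ 1)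
    (hσeB : σ eB = eB) (heB1 : Valued.v eB = 1)
    (heB : Valued.v ((ϖ ^ mstarOfRecord d)⁻¹ * ((β - 1) * ((ϖ * σ ϖ) ^ ((n₁ - d % 2) / 2))⁻¹ - eB * ((ϖ - σ ϖ) * ((ϖ * σ ϖ) ^ ((d - d % 2) / 2))⁻¹))) ≤ 1)
    (hσeC : σ eC = eC) (heC1 : Valued.v eC = 1)
    (heC : Valued.v ((ϖ ^ mstarOfRecord d)⁻¹ * ((β - α) * ((ϖ * σ ϖ) ^ ((n₃ - d % 2) / 2))⁻¹ - eC * ((ϖ - σ ϖ) * ((ϖ * σ ϖ) ^ ((d - d % 2) / 2))⁻¹))) ≤ 1) :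
    ∀ (ρ s : ℕ), 1 ≤ ρ → 1 ≤ s → 2 ∣ s → 2 * ρ + d % 2 = n₂ → n₃ ≠ n₂ + s → ∀ i : Fin 3,
      ∑ᶠ M ∈ {M : Submodule 𝒪[K] (Fin 3 → K) | M ∈ stratum σ ϖ T ![2 * ρ + s, 2 * ρ + s, 2 * ρ] ∧
          (LatticeInLevel ϖ (d % 2) (Matrix.diagonal ![α - 1, β - 1, 0]) M ∧ ¬ LatticeInLevel ϖ (d % 2 + 1) (Matrix.diagonal ![α - 1, β - 1, 0]) M ∧
            LatticeInLevel ϖ (mcOfRecord d) (Matrix.diagonal ![(α - 1) * (α - 1), (β - 1) * (β - 1), 0]) M)},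
        (labelledOddCount σ ϖ 0 i (valueClassLabel σ ϖ (α - 1) (β - 1) (mstarOfRecord d) d) M : ℚ) /
          ((((unitStabilizer M).map (unitNormMap σ 3)).relIndex (fixedUnitTorus σ 3) : ℕ) : ℚ) =
      (![(0 : ℚ), 0, (normSign σ (-1 : K) : ℚ) * (normSign σ eB : ℚ) + (normSign σ (-1 : K) : ℚ) * (normSign σ eA : ℚ)] : Fin 3 → ℚ) i / 4 * (Fintype.card 𝓀[K] : ℚ) ^ (2 * ρ - 1 + s / 2)
        * ((if 2 * d + d % 2 + 2 * ρ + s ≤ n₃ then (Fintype.card 𝓀[K] : ℚ) - 1 else 0) - (if n₃ + 2 = 2 * d + d % 2 + 2 * ρ + s then 1 else 0)) := by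
  intro ρ s hρ hs h2s hκ hfoot i
  have h2d : 2 ≤ d := two_le_d_of_v_two_lt_one hD h2
  have hmc : mcOfRecord d ≤ n0DerivedOfRecord d := mcOfRecord_le_n0DerivedOfRecord d
  have hN₀ : 3 * d - 2 + d % 2 ≤ n0DerivedOfRecord d :=
    (show 3 * d - 2 + d % 2 ≤ 2 * ((d % 2 + 2 * d - 1 + d) / 2) by omega).trans hmc
  rw [finsum_stratum_G3_kappaLocus_shell_labelledOdd_div_relIndex_eq hD h2 h2d hE hN₀ hmc T hT hσeB heB1 heB hσeC heC1 heC ρ s hρ hs h2s hκ hfoot i]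
  by_cases hF : 2 * d + d % 2 + 2 * ρ + s ≤ n₃ ∨ n₃ + 2 = 2 * d + d % 2 + 2 * ρ + s
  · -- the bracket is alive: the datum is deep, `ω_B = ω_A`
    obtain ⟨h1, -, h3⟩ := depth_mod_two_eq_of_isElementDatum hD hE (by omega : d ≤ n0DerivedOfRecord d)
    have h12 : n₁ = n₂ := by rcases isoceles_of_isElementDatum hD hE with h | h | h <;> omega
    rw [normSign_towerSign_eq_of_isElementDatum_of_deep₃ hD hE h12 (by omega) (by omega) hσeA heA1 hσeB heA heB]
    fin_cases i
    · simp
    · simp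
    · simp only [Fin.reduceFinMk, Matrix.cons_val_two, Matrix.tail_cons, Matrix.head_cons]; ring
  · -- the bracket is dead: both sides vanish
    rw [not_or] at hF
    rw [if_neg hF.1, if_neg hF.2]
    fin_cases i <;> simp

end Summit.HodgeConjecture.HodgeConjecture.Cruxes.H413.F0P3cDyRamLabelledOddKappaClassG3

end
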